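import Summits.AtomisticToContinuum.HydrodynamicLimit.Theorems.OneFlightGossipEngineEnergyCurrentTailsFirstPartnerRung0Excess
import Summits.AtomisticToContinuum.HydrodynamicLimit.Theorems.OneFlightGossipEngineEnergyCurrentTailsLevelCensusForwardWindow
import Summits.AtomisticToContinuum.HydrodynamicLimit.Theorems.OneFlightGossipEngineEnergyCurrentTailsEnergyFluxCeilingRung0
import Literature.MathematicalPhysics.KineticTheory.ShortFlightCount
import HarnessLib

/-!
# Crux `EnergyCurrentTails` (stmt-AtomisticToContinuum-9235), line `quartic-schur-ledger`, rung-0 certificate of I′: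
# S4, the weighted two-look-ahead 3-label statics `shareRung0_statics` (helper file, `--supports …-9235`)

Fix `N + 1` hard spheres of diameter `ε = ε_N = hsDiameter σ N` on `𝕋³ × ℝ³` under the homogeneous drifted Gibbs
law `G_N = localGibbsLaw σ a u θ N Φ` (constant profiles, small density; positions canonical Gibbs, velocities
i.i.d. `N(u, θ)`; the flow `Φ` is a dummy), and two look-aheads `h₁, h₂ > 0`.  For an ordered pair `(e, k)` of a
non-overlapping configuration `w` coming to contact after a FORWARD free flight of duration `≤ h₁`, the disturbed
first-partner marks of the line are charged (S1–S3 of the certificate) to the would-be partners `o ∉ {e, k}` of `e`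
within the look-ahead `h₂`, with the velocity weight `(‖v_e‖² + ‖v_o‖²)²`.  THIS FILE (S4): the charged sum

  `Σ_{o ∉ {e,k}} (𝟙{(e,o) ∈ W_{h₂}(w)} + 𝟙{(o,e) ∈ W_{h₂}(w)}) (‖v_e‖² + ‖v_o‖²)²`

has, on the forward-contact event of `(e, k)`, measurable majorants `Mw e k` with

  `E_{G_N}[Σ_{e ≠ k} Mw e k] ≤ C(u, θ) · (N+1)³ · ε⁴ h₁ h₂`,  `C = 12288 · E_{N(u,θ)} ‖w‖⁶`.

**Proof.**  (1) Geometry: forward contact of `(e, k)` within `h₁` puts a lattice lift of the minimal image of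
`x_k − x_e` into the swept tube `S₁(v_k − v_e)` of window `h₁` (`exists_latticeVec_add_mem_of_contact_fwd`,
`exists_sweptTube`, `vol ≤ 4ε²h₁‖·‖`), and `(o, e)` (equivalently `(e, o)`, `mem_wouldBePairs_symm`) would-be within
`h₂` puts a lift of `x_o − x_e` into `S₂(v_o − v_e)` of window `h₂` (`RateFloorNoBursts.exists_latticeVec_mem_of_wouldBe`);
so the charged sum is dominated by `Mw e k = Σ_{o} 𝟙{e,k,o distinct} · 2 · 𝟙_{A e k ∩ B e o} (‖v_e‖² + ‖v_o‖²)²`.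
(2) Statics (`lintegral_indicator_tubeEvent_inter_tubeEvent_le`, the weighted one-sided twin of
`ShortFlightCount.measure_windowEvent_inter_tubeEvent_le`): disintegrating `G_N = posGibbs ⊗ N(u,θ)^{⊗(N+1)}`,
Ruelle's canonical three-label bound `posGibbs_tripleEvent_le` and the Haar-versus-Lebesgue lift inequality give
`∫ 𝟙_{A∩B} W dG_N ≤ 128 ε⁴ h₁ h₂ ∫ ‖v_k − v_e‖ ‖v_o − v_e‖ W(v) dN^{⊗(N+1)}` for every measurable velocity weight
`W`.  (3) Moments: `‖v_k − v_e‖ ‖v_o − v_e‖ (‖v_e‖² + ‖v_o‖²)² ≤ 16 (‖v_e‖⁶ + ‖v_k‖⁶ + ‖v_o‖⁶)`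
(`(x+y)(x+z)(x²+z²)² ≤ 16 max⁶`), so only the ONE-label sixth Gaussian moment (finite,
`lintegral_norm_pow_gaussMeasure_ne_top`) enters; summing the `≤ (N+1)³` triples gives the claim.

References: D. Ruelle, *Statistical Mechanics: Rigorous Results* (1969) §4.2; C. Cercignani, R. Illner,
M. Pulvirenti, *The Mathematical Theory of Dilute Gases* (1994) §2.2, App. 4.A; I. Gallagher, L. Saint-Raymond,
B. Texier, *From Newton to Boltzmann* (2013) Prop. 4.1.1.
-/

noncomputable section

open scoped BigOperators Classical ENNReal InnerProductSpace
open MeasureTheory Set Filter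
open Literature.Analysis.FluidPDE Literature.MathematicalPhysics.KineticTheory
  Literature.MathematicalPhysics.StatisticalMechanics

namespace Summit.AtomisticToContinuum.HydrodynamicLimit.Theorems

namespace QuarticSchurLedger

open RateFloorLine
open Literature.Analysis.FunctionSpaces RateFloorNoBursts EnergyCurrentTailsLevelCensus

/-! ## An elementary degree-six bound -/

/-- `(x + y)(x + z)(x² + z²)² ≤ 16 (x⁶ + y⁶ + z⁶)` for `x, z ≥ 0` (and every `y`): every factor is at most
`2 max` resp. `2 max²`, and `max⁶ ≤ x⁶ + y⁶ + z⁶`. [folklore] -/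
theorem add_mul_add_mul_sq_add_sq_sq_le {x y z : ℝ} (hx : 0 ≤ x) (hz : 0 ≤ z) :
    (x + y) * (x + z) * (x ^ 2 + z ^ 2) ^ 2 ≤ 16 * (x ^ 6 + y ^ 6 + z ^ 6) := by
  set M := max x (max y z) with hM
  have hxM : x ≤ M := le_max_left _ _
  have hyM : y ≤ M := (le_max_left _ _).trans (le_max_right _ _)
  have hzM : z ≤ M := (le_max_right _ _).trans (le_max_right _ _)
  have h6 : M ^ 6 ≤ x ^ 6 + y ^ 6 + z ^ 6 := by
    have hx6 : 0 ≤ x ^ 6 := by positivity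
    have hy6 : 0 ≤ y ^ 6 := by positivity
    have hz6 : 0 ≤ z ^ 6 := by positivity
    rcases le_total x (max y z) with h | h
    · rcases le_total y z with h' | h'
      · rw [hM, max_eq_right h, max_eq_right h']; linarith
      · rw [hM, max_eq_right h, max_eq_left h']; linarith
    · rw [hM, max_eq_left h]; linarith
  calc (x + y) * (x + z) * (x ^ 2 + z ^ 2) ^ 2 ≤ (2 * M) * (2 * M) * (2 * M ^ 2) ^ 2 := by
        gcongr
        · linarith
        · linarith
        · nlinarith
    _ = 16 * M ^ 6 := by ring
    _ ≤ 16 * (x ^ 6 + y ^ 6 + z ^ 6) := by linarith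

/-! ## The weighted three-label statics of two forward tube events with a shared label -/

/-- **Weighted three-label statics of two one-sided tube events sharing a label** (the weighted, ONE-SIDED twin
of `ShortFlightCount.measure_windowEvent_inter_tubeEvent_le`).  Under the rung-0 law, for labels `p, m, j'` with
the three-label canonical bound `htriple` (`≤ 8 vol T · vol T'`, Ruelle), swept-tube families `S₁` of window `h₁`
and `S₂` of window `h₂` (`vol ≤ 4ε²·window·‖·‖`), the minimal-image lift inequality `hlift` and a measurable weight
`W` of the velocities: the Gibbs integral over the event "a lift of `x_m − x_p` lies in `S₁(v_m − v_p)` AND a lift of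
`x_{j'} − x_p` lies in `S₂(v_{j'} − v_p)`" of `W(v)` is at most
`128 ε⁴ h₁ h₂ · ∫ ‖v_m − v_p‖ ‖v_{j'} − v_p‖ W(v) dN(u,θ)^{⊗(N+1)}(v)` (disintegration positions ⊗ velocities).
[folklore] -/
theorem lintegral_indicator_tubeEvent_inter_tubeEvent_le {σ : ℝ} (hσ2 : σ ≤ 1 / 2) {a θ : ℝ} (ha : 0 < a)
    (hθ : 0 < θ) (u : V3) {N : ℕ} (Φ : HardSphereFlow (Torus.geometry (Fin 3)) (hsDiameter σ N) (N + 1))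
    {p m j' : Fin (N + 1)}
    (htriple : ∀ T T' : Set T3, MeasurableSet T → MeasurableSet T' →
      posGibbsMeasure (fun _ : T3 => (1 : ℝ)) (hsDiameter σ N) (N + 1) {x | x m - x p ∈ T ∧ x j' - x p ∈ T'} ≤
        8 * (volume T * volume T'))
    {h₁ h₂ : ℝ} (hh₁ : 0 ≤ h₁) (hh₂ : 0 ≤ h₂) {S₁ S₂ : V3 → Set V3}
    (hS₁m : MeasurableSet {q : V3 × V3 | q.1 ∈ S₁ q.2}) (hS₂m : MeasurableSet {q : V3 × V3 | q.1 ∈ S₂ q.2})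
    (hS₁vol : ∀ v, volume (S₁ v) ≤ ENNReal.ofReal (4 * hsDiameter σ N ^ 2 * h₁ * ‖v‖))
    (hS₂vol : ∀ v, volume (S₂ v) ≤ ENNReal.ofReal (4 * hsDiameter σ N ^ 2 * h₂ * ‖v‖))
    (hlift : ∀ B : Set V3, MeasurableSet B →
      volume {x : T3 | ∃ k : Fin 3 → ℤ, Torus.reprSym x + Torus.latticeVec k ∈ B} ≤ volume B)
    {W : (Fin (N + 1) → V3) → ℝ≥0∞} (hW : Measurable W) :
    ∫⁻ w, ({w : Config (N + 1) (Fin 3) T3 | ∃ k : Fin 3 → ℤ,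
            Torus.reprSym ((w m).1 - (w p).1) + Torus.latticeVec k ∈ S₁ ((w m).2 - (w p).2)} ∩
          {w | ∃ k : Fin 3 → ℤ, Torus.reprSym ((w j').1 - (w p).1) + Torus.latticeVec k ∈
            S₂ ((w j').2 - (w p).2)}).indicator (fun w => W fun i => (w i).2) w
        ∂(localGibbsLaw σ (fun _ => a) (fun _ => u) (fun _ => θ) N Φ) ≤
      ENNReal.ofReal (128 * hsDiameter σ N ^ 4 * h₁ * h₂) *
        ∫⁻ v, ENNReal.ofReal (‖v m - v p‖ * ‖v j' - v p‖) * W v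
          ∂(Measure.pi fun _ : Fin (N + 1) => gaussMeasure u θ) := by
  set ε := hsDiameter σ N
  -- measurable sections of the tube families
  have hS₁u : ∀ v : V3, MeasurableSet (S₁ v) := fun v => hS₁m.preimage (measurable_id.prodMk measurable_const)
  have hS₂u : ∀ v : V3, MeasurableSet (S₂ v) := fun v => hS₂m.preimage (measurable_id.prodMk measurable_const)
  -- the position events for fixed velocities
  set T₁ : (Fin (N + 1) → V3) → Set T3 := fun v =>
    {y | ∃ k : Fin 3 → ℤ, Torus.reprSym y + Torus.latticeVec k ∈ S₁ (v m - v p)} with hT₁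
  set T₂ : (Fin (N + 1) → V3) → Set T3 := fun v =>
    {y | ∃ k : Fin 3 → ℤ, Torus.reprSym y + Torus.latticeVec k ∈ S₂ (v j' - v p)} with hT₂
  have hpre : ∀ B : Set V3, MeasurableSet B →
      MeasurableSet {y : T3 | ∃ k : Fin 3 → ℤ, Torus.reprSym y + Torus.latticeVec k ∈ B} := by
    intro B hB
    have : {y : T3 | ∃ k : Fin 3 → ℤ, Torus.reprSym y + Torus.latticeVec k ∈ B} =
        ⋃ k : Fin 3 → ℤ, (fun y : T3 => Torus.reprSym y + Torus.latticeVec k) ⁻¹' B := by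
      ext y; simp only [mem_setOf_eq, mem_iUnion, mem_preimage]
    rw [this]
    exact MeasurableSet.iUnion fun k => hB.preimage (Torus.measurable_reprSym.add_const _)
  have hT₁m : ∀ v, MeasurableSet (T₁ v) := fun v => hpre _ (hS₁u _)
  have hT₂m : ∀ v, MeasurableSet (T₂ v) := fun v => hpre _ (hS₂u _)
  have hT₁vol : ∀ v, volume (T₁ v) ≤ ENNReal.ofReal (4 * ε ^ 2 * h₁ * ‖v m - v p‖) := fun v =>
    (hlift _ (hS₁u _)).trans (hS₁vol _)
  have hT₂vol : ∀ v, volume (T₂ v) ≤ ENNReal.ofReal (4 * ε ^ 2 * h₂ * ‖v j' - v p‖) := fun v =>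
    (hlift _ (hS₂u _)).trans (hS₂vol _)
  -- the event and its measurability
  set A : Set (Config (N + 1) (Fin 3) T3) :=
    {w | ∃ k : Fin 3 → ℤ, Torus.reprSym ((w m).1 - (w p).1) + Torus.latticeVec k ∈ S₁ ((w m).2 - (w p).2)} ∩
      {w | ∃ k : Fin 3 → ℤ, Torus.reprSym ((w j').1 - (w p).1) + Torus.latticeVec k ∈
        S₂ ((w j').2 - (w p).2)} with hA
  have hψm : ∀ (i : Fin (N + 1)) (k : Fin 3 → ℤ), Measurable fun w : Config (N + 1) (Fin 3) T3 =>
      (Torus.reprSym ((w i).1 - (w p).1) + Torus.latticeVec k, (w i).2 - (w p).2) := fun i k =>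
    ((Torus.measurable_reprSym.comp ((measurable_pi_apply i).fst.sub (measurable_pi_apply p).fst)).add_const
      _).prodMk ((measurable_pi_apply i).snd.sub (measurable_pi_apply p).snd)
  have hEv : ∀ (S : V3 → Set V3) (i : Fin (N + 1)), {w : Config (N + 1) (Fin 3) T3 | ∃ k : Fin 3 → ℤ,
      Torus.reprSym ((w i).1 - (w p).1) + Torus.latticeVec k ∈ S ((w i).2 - (w p).2)} =
      ⋃ k : Fin 3 → ℤ, (fun w : Config (N + 1) (Fin 3) T3 =>
        (Torus.reprSym ((w i).1 - (w p).1) + Torus.latticeVec k, (w i).2 - (w p).2)) ⁻¹'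
          {q : V3 × V3 | q.1 ∈ S q.2} := fun S i => by
    ext w; simp only [mem_setOf_eq, mem_iUnion, mem_preimage]
  have hAm : MeasurableSet A := by
    rw [hA, hEv S₁ m, hEv S₂ j']
    exact (MeasurableSet.iUnion fun k => hS₁m.preimage (hψm m k)).inter
      (MeasurableSet.iUnion fun k => hS₂m.preimage (hψm j' k))
  -- the integrand
  set F : Config (N + 1) (Fin 3) T3 → ℝ≥0∞ := A.indicator fun w => W fun i => (w i).2 with hF
  have hWc : Measurable fun w : Config (N + 1) (Fin 3) T3 => W fun i => (w i).2 :=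
    hW.comp (measurable_pi_lambda _ fun i => (measurable_pi_apply i).snd)
  have hFm : Measurable F := hWc.indicator hAm
  -- the rung-0 law
  set Q := posGibbsMeasure (fun _ : T3 => a) ε (N + 1) with hQ
  set Γ : Measure (Fin (N + 1) → V3) := Measure.pi fun _ => gaussMeasure u θ with hΓ
  have hlaw : localGibbsLaw σ (fun _ => a) (fun _ => u) (fun _ => θ) N Φ = (Q.prod Γ).map zipConfig := by
    rw [localGibbsLaw_eq, localGibbsMeasure_rung0_eq_map σ ha.le hθ u N]
  haveI : IsProbabilityMeasure Q := isProbabilityMeasure_posGibbsMeasure continuous_const (fun _ => ha) hσ2 N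
  haveI : IsProbabilityMeasure Γ := by rw [hΓ]; infer_instance
  -- the sections: Ruelle's three-label bound and the swept-tube volumes
  have hsec : ∀ v : Fin (N + 1) → V3, ∫⁻ x, F (zipConfig (x, v)) ∂Q ≤
      W v * ENNReal.ofReal (128 * ε ^ 4 * h₁ * h₂ * (‖v m - v p‖ * ‖v j' - v p‖)) := by
    intro v
    have hle : ∀ x, F (zipConfig (x, v)) ≤
        {x : Fin (N + 1) → T3 | x m - x p ∈ T₁ v ∧ x j' - x p ∈ T₂ v}.indicator (fun _ => W v) x := by
      intro x
      by_cases hx : zipConfig (x, v) ∈ A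
      · have hx' : x ∈ {x : Fin (N + 1) → T3 | x m - x p ∈ T₁ v ∧ x j' - x p ∈ T₂ v} := by
          simpa only [hA, hT₁, hT₂, mem_inter_iff, mem_setOf_eq, zipConfig_apply] using hx
        rw [hF, indicator_of_mem hx, indicator_of_mem hx']
        simp only [zipConfig_apply, le_refl]
      · rw [hF, indicator_of_notMem hx]
        exact bot_le
    calc ∫⁻ x, F (zipConfig (x, v)) ∂Q
        ≤ ∫⁻ x, {x : Fin (N + 1) → T3 | x m - x p ∈ T₁ v ∧ x j' - x p ∈ T₂ v}.indicator (fun _ => W v) x ∂Q :=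
          lintegral_mono hle
      _ ≤ W v * Q {x | x m - x p ∈ T₁ v ∧ x j' - x p ∈ T₂ v} := lintegral_indicator_const_le _ _
      _ ≤ W v * (8 * (volume (T₁ v) * volume (T₂ v))) := by
          have hQ' : Q {x | x m - x p ∈ T₁ v ∧ x j' - x p ∈ T₂ v} ≤ 8 * (volume (T₁ v) * volume (T₂ v)) := by
            rw [hQ, posGibbsMeasure_const_eq_one ha]
            exact htriple _ _ (hT₁m v) (hT₂m v)
          gcongr
      _ ≤ W v * (8 * (ENNReal.ofReal (4 * ε ^ 2 * h₁ * ‖v m - v p‖) *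
            ENNReal.ofReal (4 * ε ^ 2 * h₂ * ‖v j' - v p‖))) := by
          gcongr
          · exact hT₁vol v
          · exact hT₂vol v
      _ = W v * ENNReal.ofReal (128 * ε ^ 4 * h₁ * h₂ * (‖v m - v p‖ * ‖v j' - v p‖)) := by
          rw [← ENNReal.ofReal_mul (by positivity), ← ENNReal.ofReal_ofNat 8,
            ← ENNReal.ofReal_mul (by norm_num)]
          congr 2
          ring
  calc ∫⁻ w, F w ∂(localGibbsLaw σ (fun _ => a) (fun _ => u) (fun _ => θ) N Φ)
      = ∫⁻ pr, F (zipConfig pr) ∂(Q.prod Γ) := by rw [hlaw, lintegral_map hFm measurable_zipConfig]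
    _ = ∫⁻ v, ∫⁻ x, F (zipConfig (x, v)) ∂Q ∂Γ :=
        lintegral_prod_symm _ (hFm.comp measurable_zipConfig).aemeasurable
    _ ≤ ∫⁻ v, W v * ENNReal.ofReal (128 * ε ^ 4 * h₁ * h₂ * (‖v m - v p‖ * ‖v j' - v p‖)) ∂Γ :=
        lintegral_mono hsec
    _ = ENNReal.ofReal (128 * ε ^ 4 * h₁ * h₂) *
          ∫⁻ v, ENNReal.ofReal (‖v m - v p‖ * ‖v j' - v p‖) * W v ∂Γ := by
        rw [← lintegral_const_mul' _ _ ENNReal.ofReal_ne_top]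
        refine lintegral_congr fun v => ?_
        rw [ENNReal.ofReal_mul (by positivity)]
        ring

/-! ## The registered helper S4 -/

/-- **S4 · 3-label statics, weighted, two look-aheads: forward contact of `(e,k)` within `h₁` and `(e,o)` would-be
within `h₂`.**  For constant profiles, small density, every flow: there is `C = C(u, θ) ≥ 0` such that for all `N`,
`h₁, h₂ > 0` the charged sum `Σ_{o ∉ {e,k}} (𝟙{(e,o) ∈ W_{h₂}} + 𝟙{(o,e) ∈ W_{h₂}}) (‖v_e‖² + ‖v_o‖²)²` has, on the
forward-contact event of `(e, k)` within `[0, h₁]`, measurable majorants `Mw e k` with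
`E_{G_N}[Σ_{e ≠ k} Mw e k] ≤ C (N+1)³ ε_N⁴ h₁ h₂`. [folklore] -/
theorem shareRung0_statics : ∀ (σ : ℝ), 0 < σ → σ ≤ 1 / 2 → SmallDensity uniformProfile σ → ∀ (a θ : ℝ), 0 < a → 0 < θ → ∀ (u : V3), ∃ C : ℝ, 0 ≤ C ∧ ∀ (N : ℕ) (Φ : HardSphereFlow (Torus.geometry (Fin 3)) (hsDiameter σ N) (N + 1)) (h₁ h₂ : ℝ), 0 < h₁ → 0 < h₂ → ∃ Mw : Fin (N + 1) → Fin (N + 1) → Config (N + 1) (Fin 3) T3 → ℝ≥0∞, (∀ e k, Measurable (Mw e k)) ∧ (∀ w ∈ hardSphereDomain (Torus.geometry (Fin 3)) (N + 1) (hsDiameter σ N), ∀ e k : Fin (N + 1), e ≠ k → (∃ t ∈ Set.Icc 0 h₁, ‖(Torus.geometry (Fin 3)).sepVec ((freeFlight (Torus.geometry (Fin 3)) t w e).1) ((freeFlight (Torus.geometry (Fin 3)) t w k).1)‖ = hsDiameter σ N) → (∑ o : Fin (N + 1), (if o ≠ e ∧ o ≠ k then ((if (e, o) ∈ wouldBePairs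 (hsDiameter σ N) h₂ w then ENNReal.ofReal ((‖(w e).2‖ ^ 2 + ‖(w o).2‖ ^ 2) ^ 2) else 0) + (if (o, e) ∈ wouldBePairs (hsDiameter σ N) h₂ w then ENNReal.ofReal ((‖(w o).2‖ ^ 2 + ‖(w e).2‖ ^ 2) ^ 2) else 0)) else 0)) ≤ Mw e k w) ∧ ∫⁻ w, (∑ e : Fin (N + 1), ∑ k : Fin (N + 1), if e ≠ k then Mw e k w else 0) ∂(localGibbsLaw σ (fun _ => a) (fun _ => u) (fun _ => θ) N Φ) ≤ ENNReal.ofReal (C * (((N + 1 : ℕ) : ℝ) ^ 3 * (hsDiameter σ N ^ 4 * (h₁ * h₂)))) := by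
  intro σ hσ hσ2 hsm a θ ha hθ u
  -- the sixth Gaussian moment, as a real constant
  obtain ⟨C₆, hC₆0, hC₆⟩ : ∃ C : ℝ, 0 ≤ C ∧
      ∫⁻ w, ENNReal.ofReal (‖w‖ ^ 6) ∂(gaussMeasure u θ) = ENNReal.ofReal C :=
    ⟨_, ENNReal.toReal_nonneg,
      (ENNReal.ofReal_toReal (lintegral_norm_pow_gaussMeasure_ne_top u θ (k := 6) (by norm_num))).symm⟩
  refine ⟨12288 * C₆, by positivity, ?_⟩
  intro N Φ h₁ h₂ hh₁ hh₂
  have hε0 : 0 < hsDiameter σ N := hsDiameter_pos hσ N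
  set ε := hsDiameter σ N
  set P := localGibbsLaw σ (fun _ => a) (fun _ => u) (fun _ => θ) N Φ
  set Γ : Measure (Fin (N + 1) → V3) := Measure.pi fun _ => gaussMeasure u θ with hΓ
  -- swept tubes of windows `h₁`, `h₂` and the lift inequality
  obtain ⟨S₁, hS₁m, hS₁vol, hS₁⟩ := exists_sweptTube (h := h₁) hε0 hh₁.le
  obtain ⟨S₂, hS₂m, hS₂vol, hS₂⟩ := exists_sweptTube (h := h₂) hε0 hh₂.le
  have hlift : ∀ B : Set V3, MeasurableSet B →
      volume {x : T3 | ∃ k : Fin 3 → ℤ, Torus.reprSym x + Torus.latticeVec k ∈ B} ≤ volume B :=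
    fun B hB => by simpa only [sub_zero] using volume_setOf_exists_reprSym_add_latticeVec_mem_le 0 hB
  -- the tube events relative to the shared label `e`
  set Ev : (V3 → Set V3) → Fin (N + 1) → Fin (N + 1) → Set (Config (N + 1) (Fin 3) T3) := fun S e q =>
    {w | ∃ k : Fin 3 → ℤ, Torus.reprSym ((w q).1 - (w e).1) + Torus.latticeVec k ∈ S ((w q).2 - (w e).2)}
    with hEvdef
  have hψm : ∀ (i j : Fin (N + 1)) (k : Fin 3 → ℤ), Measurable fun w : Config (N + 1) (Fin 3) T3 =>
      (Torus.reprSym ((w i).1 - (w j).1) + Torus.latticeVec k, (w i).2 - (w j).2) := fun i j k =>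
    ((Torus.measurable_reprSym.comp ((measurable_pi_apply i).fst.sub (measurable_pi_apply j).fst)).add_const
      _).prodMk ((measurable_pi_apply i).snd.sub (measurable_pi_apply j).snd)
  have hEvm : ∀ S : V3 → Set V3, MeasurableSet {q : V3 × V3 | q.1 ∈ S q.2} →
      ∀ e q, MeasurableSet (Ev S e q) := by
    intro S hSm e q
    have h1 : Ev S e q = ⋃ k : Fin 3 → ℤ, (fun w : Config (N + 1) (Fin 3) T3 =>
        (Torus.reprSym ((w q).1 - (w e).1) + Torus.latticeVec k, (w q).2 - (w e).2)) ⁻¹'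
          {q : V3 × V3 | q.1 ∈ S q.2} := by
      ext w; simp only [hEvdef, mem_setOf_eq, mem_iUnion, mem_preimage]
    exact h1 ▸ MeasurableSet.iUnion fun k => hSm.preimage (hψm q e k)
  -- the velocity weight (an opaque name: no definitional unfolding during unification)
  obtain ⟨Wt, hWt⟩ : ∃ Wt : Fin (N + 1) → Fin (N + 1) → (Fin (N + 1) → V3) → ℝ≥0∞,
      Wt = fun e o v => ENNReal.ofReal ((‖v e‖ ^ 2 + ‖v o‖ ^ 2) ^ 2) := ⟨_, rfl⟩
  have hWtm : ∀ e o, Measurable (Wt e o) := fun e o => by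
    simp only [hWt]
    fun_prop
  have hWtc : ∀ e o, Measurable fun w : Config (N + 1) (Fin 3) T3 => Wt e o fun i => (w i).2 := fun e o => by
    simp only [hWt]
    fun_prop
  -- the triple summand and the majorant
  set f₃ : Fin (N + 1) → Fin (N + 1) → Fin (N + 1) → Config (N + 1) (Fin 3) T3 → ℝ≥0∞ := fun e k o w =>
    if e ≠ k ∧ e ≠ o ∧ k ≠ o then 2 * (Ev S₁ e k ∩ Ev S₂ e o).indicator (fun w => Wt e o fun i => (w i).2) w
    else 0 with hf₃
  have hf₃m : ∀ e k o, Measurable (f₃ e k o) := fun e k o => by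
    by_cases hcd : e ≠ k ∧ e ≠ o ∧ k ≠ o
    · simp only [hf₃, if_pos hcd]
      exact ((hWtc e o).indicator ((hEvm S₁ hS₁m e k).inter (hEvm S₂ hS₂m e o))).const_mul 2
    · simp only [hf₃, if_neg hcd]
      exact measurable_const
  refine ⟨fun e k w => ∑ o, f₃ e k o w, fun e k => Finset.measurable_sum _ fun o _ => hf₃m e k o, ?_, ?_⟩
  · -- domination on the forward-contact event
    rintro w hw e k hek ⟨t, ht, hc⟩
    have hwA : w ∈ Ev S₁ e k := by
      have hc' : ‖(Torus.geometry (Fin 3)).sepVec ((freeFlight (Torus.geometry (Fin 3)) t w k).1)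
          ((freeFlight (Torus.geometry (Fin 3)) t w e).1)‖ = ε := by
        rw [Torus.norm_geometry_sepVec, Torus.euclidDist_comm, ← Torus.norm_geometry_sepVec]
        exact hc
      exact exists_latticeVec_add_mem_of_contact_fwd hS₁ hw hek.symm ht hc'
    have hcovB : ∀ o, (o, e) ∈ wouldBePairs ε h₂ w → w ∈ Ev S₂ e o := fun o hoe => by
      obtain ⟨hne, hwb⟩ := (mem_wouldBePairs_iff ε h₂ w (o, e)).1 hoe
      exact exists_latticeVec_mem_of_wouldBe hS₂ hw hne hwb
    change _ ≤ ∑ o, f₃ e k o w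
    refine Finset.sum_le_sum fun o _ => ?_
    by_cases ho : o ≠ e ∧ o ≠ k
    · have hcd : e ≠ k ∧ e ≠ o ∧ k ≠ o := ⟨hek, fun h => ho.1 h.symm, fun h => ho.2 h.symm⟩
      rw [if_pos ho]
      simp only [hf₃, hWt, if_pos hcd, two_mul]
      refine add_le_add ?_ ?_
      · by_cases heo : (e, o) ∈ wouldBePairs ε h₂ w
        · rw [if_pos heo, indicator_of_mem (mem_inter hwA (hcovB o ((mem_wouldBePairs_symm ε h₂ w e o).1 heo)))]
        · rw [if_neg heo]
          exact zero_le
      · by_cases hoe : (o, e) ∈ wouldBePairs ε h₂ w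
        · rw [if_pos hoe, indicator_of_mem (mem_inter hwA (hcovB o hoe)), add_comm (‖(w o).2‖ ^ 2)]
        · rw [if_neg hoe]
          exact zero_le
    · rw [if_neg ho]
      exact zero_le
  · -- the mean
    have hmom : ∀ i : Fin (N + 1), ∫⁻ v, ENNReal.ofReal (‖v i‖ ^ 6) ∂Γ = ENNReal.ofReal C₆ := fun i => by
      rw [hΓ, ← hC₆]
      exact (measurePreserving_eval (fun _ : Fin (N + 1) => gaussMeasure u θ) i).lintegral_comp
        (f := fun w : V3 => ENNReal.ofReal (‖w‖ ^ 6)) (by fun_prop)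
    have hpoly : ∀ (v : Fin (N + 1) → V3) (e k o : Fin (N + 1)),
        ENNReal.ofReal (‖v k - v e‖ * ‖v o - v e‖) * Wt e o v ≤
          16 * (ENNReal.ofReal (‖v e‖ ^ 6) + ENNReal.ofReal (‖v k‖ ^ 6) + ENNReal.ofReal (‖v o‖ ^ 6)) := by
      intro v e k o
      simp only [hWt]
      rw [← ENNReal.ofReal_mul (by positivity), ← ENNReal.ofReal_add (by positivity) (by positivity),
        ← ENNReal.ofReal_add (by positivity) (by positivity), ← ENNReal.ofReal_ofNat 16,
        ← ENNReal.ofReal_mul (by norm_num)]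
      refine ENNReal.ofReal_le_ofReal ?_
      calc ‖v k - v e‖ * ‖v o - v e‖ * (‖v e‖ ^ 2 + ‖v o‖ ^ 2) ^ 2
          ≤ (‖v e‖ + ‖v k‖) * (‖v e‖ + ‖v o‖) * (‖v e‖ ^ 2 + ‖v o‖ ^ 2) ^ 2 := by
            gcongr
            · linarith [norm_sub_le (v k) (v e)]
            · linarith [norm_sub_le (v o) (v e)]
        _ ≤ 16 * (‖v e‖ ^ 6 + ‖v k‖ ^ 6 + ‖v o‖ ^ 6) :=
            add_mul_add_mul_sq_add_sq_sq_le (norm_nonneg _) (norm_nonneg _)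
    have hterm : ∀ e k o, ∫⁻ w, f₃ e k o w ∂P ≤ ENNReal.ofReal (12288 * C₆ * (ε ^ 4 * (h₁ * h₂))) := by
      intro e k o
      by_cases hcd : e ≠ k ∧ e ≠ o ∧ k ≠ o
      · simp only [hf₃, if_pos hcd]
        rw [lintegral_const_mul _ ((hWtc e o).indicator ((hEvm S₁ hS₁m e k).inter (hEvm S₂ hS₂m e o)))]
        calc 2 * ∫⁻ w, (Ev S₁ e k ∩ Ev S₂ e o).indicator (fun w => Wt e o fun i => (w i).2) w ∂P
            ≤ 2 * (ENNReal.ofReal (128 * ε ^ 4 * h₁ * h₂) *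
                ∫⁻ v, ENNReal.ofReal (‖v k - v e‖ * ‖v o - v e‖) * Wt e o v ∂Γ) := by
              gcongr
              exact lintegral_indicator_tubeEvent_inter_tubeEvent_le hσ2 ha hθ u Φ
                (fun T T' hT hT' => posGibbs_tripleEvent_le hsm hcd.1 hcd.2.1 hcd.2.2 hT hT') hh₁.le hh₂.le
                hS₁m hS₂m hS₁vol hS₂vol hlift (hWtm e o)
          _ ≤ 2 * (ENNReal.ofReal (128 * ε ^ 4 * h₁ * h₂) *
                ∫⁻ v, 16 * (ENNReal.ofReal (‖v e‖ ^ 6) + ENNReal.ofReal (‖v k‖ ^ 6) +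
                  ENNReal.ofReal (‖v o‖ ^ 6)) ∂Γ) := by
              gcongr 2 * (_ * ?_)
              exact lintegral_mono fun v => hpoly v e k o
          _ = ENNReal.ofReal (12288 * C₆ * (ε ^ 4 * (h₁ * h₂))) := by
              rw [lintegral_const_mul _ (by fun_prop), lintegral_add_left (by fun_prop),
                lintegral_add_left (by fun_prop), hmom e, hmom k, hmom o,
                ← ENNReal.ofReal_add hC₆0 hC₆0, ← ENNReal.ofReal_add (add_nonneg hC₆0 hC₆0) hC₆0,
                ← ENNReal.ofReal_ofNat 16, ← ENNReal.ofReal_mul (by norm_num),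
                ← ENNReal.ofReal_mul (by positivity), ← ENNReal.ofReal_ofNat 2,
                ← ENNReal.ofReal_mul (by norm_num)]
              congr 1
              ring
      · simp only [hf₃, if_neg hcd, lintegral_const, zero_mul, zero_le]
    have hn : ((N + 1 : ℕ) : ℝ≥0∞) = ENNReal.ofReal ((N + 1 : ℕ) : ℝ) := (ENNReal.ofReal_natCast _).symm
    calc ∫⁻ w, (∑ e, ∑ k, if e ≠ k then ∑ o, f₃ e k o w else 0) ∂P
        ≤ ∫⁻ w, ∑ e, ∑ k, ∑ o, f₃ e k o w ∂P := by
          refine lintegral_mono fun w => Finset.sum_le_sum fun e _ => Finset.sum_le_sum fun k _ => ?_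
          split_ifs
          · exact le_rfl
          · exact zero_le
      _ = ∑ e, ∑ k, ∑ o, ∫⁻ w, f₃ e k o w ∂P := by
          rw [lintegral_finsetSum _ fun e _ => Finset.measurable_sum _ fun k _ =>
            Finset.measurable_sum _ fun o _ => hf₃m e k o]
          refine Finset.sum_congr rfl fun e _ => ?_
          rw [lintegral_finsetSum _ fun k _ => Finset.measurable_sum _ fun o _ => hf₃m e k o]
          exact Finset.sum_congr rfl fun k _ => lintegral_finsetSum _ fun o _ => hf₃m e k o
      _ ≤ ∑ _e : Fin (N + 1), ∑ _k : Fin (N + 1), ∑ _o : Fin (N + 1),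
            ENNReal.ofReal (12288 * C₆ * (ε ^ 4 * (h₁ * h₂))) := by
          gcongr with e _ k _ o _
          exact hterm e k o
      _ = ((N + 1 : ℕ) : ℝ≥0∞) ^ 3 * ENNReal.ofReal (12288 * C₆ * (ε ^ 4 * (h₁ * h₂))) := by
          simp only [Finset.sum_const, Finset.card_univ, Fintype.card_fin, nsmul_eq_mul]; ring
      _ = ENNReal.ofReal (12288 * C₆ * (((N + 1 : ℕ) : ℝ) ^ 3 * (ε ^ 4 * (h₁ * h₂)))) := by
          rw [hn, ← ENNReal.ofReal_pow (Nat.cast_nonneg _), ← ENNReal.ofReal_mul (by positivity)]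
          congr 1
          ring

end QuarticSchurLedger

end Summit.AtomisticToContinuum.HydrodynamicLimit.Theorems

end
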